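import Mathlib
import HarnessLib
import Literature.Combinatorics.Additive.StepBeyondKempermanSubcaseTwo
import Literature.Combinatorics.Additive.TwoComponentTransfer
import Literature.Combinatorics.Additive.StepBeyondKempermanMinThree
import Literature.Combinatorics.Additive.StepBeyondKempermanSubcaseThree

/-!
# Grynkiewicz 2009, Theorem 4.1, §6 Subcase 4 (`|B(e)| = 2`)

[cite: Grynkiewicz2009, §6 Subcase 4 (proof of Thm 4.1, pp. 32–34)] [tag: critical-pair] [tag: inverse-theorem]

Topic `Literature/Combinatorics/Additive`.  Cell `mm-stpp` (D-0046), seat `mm-stpp-lit` (gen 25); the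
port of D. J. Grynkiewicz, *A step beyond Kemperman's structure theorem*, Mathematika **55** (2009)
67–114 continued.  SUBCASE 4 of CASE I (print pp. 32–34; arXiv:0710.1041 «Case 4» pp. 27–28, which
extends `B` instead of `A` in ¶2–3 — the PRINT is followed): `e ∈ A − B` maximal with
`|B(e)| = |(e + B) ∩ A| = 2` and `A(e) + B(e)` aperiodic, under the standing data of the deep core
(`|A| ≥ |B| ≥ 4`, Claims 4, 5, 8, 10, (45)–(51)) and the printed induction hypothesis (the theorem for
the core pairs `(X, Y)` of `G` with `min(|X|, |Y|) < |B|`, or `= |B|` and `|X| + |Y| > |A| + |B|`).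
`subcaseFour_false_of_terminal` carries the argument down to its last paragraph: «it follows that case
`G` finite will be complete once we complete the case with `|A| = |B| = 4` and
`c_d(A) = c_d(B) = c_d(A + B) = 2` (as then we can apply this case with `−B` and `\overline{A + B}`)»
(p. 33), the hypothesis `terminal`; `terminal_false` discharges it (p. 33 last ¶ – p. 34); and
`subcaseFour_false` is SUBCASE 4 with exactly the antecedents of the hypothesis `four` of
`StepBeyondKempermanFinite.lean`.

TOOLS (general, reusable):
* `Grynkiewicz2009.card_le_of_seventeen` — «the quasi-period from KST must be `G` … type (III) or (IV)
  with `H = G`»: for `0 ∈ A`, `⟨A⟩ = G`, `d⊆(A, QP) ≥ 2`, `d⊆(A, QAP_d) ≥ 2` (all `d ≠ 0`), `|A|, |B′| ≥ 2`,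
  `|A + B′| = |A| + |B′|`, `A + B′` aperiodic: (17) for `(A, B′)` forces `|G| ≤ |A + B′| + 2` (the
  contrapositive reading of `not_seventeen_of_two_le_subsetDist`). [§6 p. 33]
* `Grynkiewicz2009.isNonExtendible_of_two_le_subsetDist` — «If the pair … is extendible, then … in view
  of KST … `d⊆(B, AP) ≤ 1`, a contradiction»: under the same data with `|A + B′| + 2 ≤ |G|`, the pair is
  non-extendible both ways (a one-sided extension is a critical pair with the same aperiodic sumset; KST
  with quasi-period `G` leaves types (II) — excluded by (50) — and (III)/(IV) — too big). [§6 p. 33 ¶3]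
* `Grynkiewicz2009.card_eq_of_isGrynkiewiczDecomp` — the decomposition alternative of the theorem for a
  pair `(X, Y)` with `0 ∈ X`, `⟨X⟩ = G`, `d⊆(X, QP) ≥ 2`, `|X| ≥ 4`, `|Y| ≥ 3` has `H = G`
  (`IsGrynkiewiczDecomp.eq_top_of_not_isQuasiPeriodic`) and type (V)–(VIII): (V), (VI) are excluded by
  the sizes, (VIII) by `IsTypeVIII.subsetDist_isQuasiPeriodic_le_one_left`, and (VII) leaves exactly
  `|Y| = 3`, `|G| = |X| + 6`. [§6 p. 33: «we cannot have type (V)–(VII) … cannot have type (VIII)»]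
* `Grynkiewicz2009.card_le_of_conclusion` — the two combined.

SUBCASE 4, ¶1–¶4 (`subcaseFour_false_of_terminal`, hypotheses = the antecedents of the hypothesis
`four` of `StepBeyondKempermanFinite.lean` + `terminal`):
¶1 `(A(e), B(e))` is critical with `A(e) + B(e) = e + A + B` (`eTransform_card_add_eq_and_isNonExtendible`);
`B(e) = {y, y + d}` gives `c_d(A(e)) = 2`, hence `c_d(A + B) = c_d(\overline{A + B}) ≤ 2`
(`componentCount_add_pair_zero_le`, `componentCount_compl`), and `= 2` since `c_d = 0` means `d`-periodic
((45)) and `c_d = 1` means quasi-progression ((51)); Lemma 5.9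
(`componentCount_le_two_or_seventeen_of_componentCount_eq_two`) for `(−γ + \overline{A + B}, −B)` (a pair by
Proposition 2.4 `isNonExtendible_pair_neg_compl'`, Claims 9–10, (45), (46), (48); its second alternative
is excluded by (47) for `A` and (50) for `B`) gives `c_d(A), c_d(B) ≤ 2`, hence `= 2` likewise.
¶2 (61) `d⊆(A + B + {0, d}, 𝒫) ≥ 2`: a periodic `P ⊇ A + {0,d} + B` has `|P ∖ (A + B)| ≥ 3` (Claim 5),
so one more point than `A + B + {0, d}`; if `|\overline{A + B}| ≥ 5` Claim 2 (`seventeen_of_addStab_insert_ne`)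
and `not_seventeen_of_two_le_subsetDist` (for `B`) contradict, and if `|\overline{A + B}| = 4` then
`P = G ∖ {pt}` is not periodic.  (The print's route via Corollary 4.2 and KST is replaced by these two
kernel facts.)
¶3 `(A + {0, d}, B)` is non-extendible (`isNonExtendible_of_two_le_subsetDist` for `B`), `A + {0, d}` is
generating and not quasi-periodic (Lemma 5.4 `not_isQuasiPeriodic_and_closure_eq_top`; the print cites
Lemma 5.3), the induction hypothesis applies to `(A + {0,d}, B)` and `card_le_of_conclusion` (for `B`)
yields `|\overline{A + B}| = 4`.
¶4 `|B| ≥ 5`: the induction hypothesis for the dual pair `(−A, −γ + \overline{A + B})` (Prop 2.4, (45),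
(46), (48)) and `card_le_of_conclusion` (for `−A`; the print cites Corollary 4.3) contradict; so
`|B| = |\overline{A + B}| = 4`, and either `|A| = 4` — `terminal` for `(A, B)` — or `terminal` for
`(−B, −γ + \overline{A + B})` (sizes `4, 4`; `c_d` all `2` by `componentCount_neg/compl/vadd`; its Claim-8
datum from `card_layerWith_le_one_and_or_seventeen`, whose (17) alternative `card_le_of_seventeen` excludes).

THE TERMINAL CONFIGURATION (`terminal_false`, p. 33 last ¶ – p. 34): first «there are no unique
expression elements in `A + B`» — a unique expression element `a + b` gives the pair `(A, B ∖ b)` with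
`|A + (B ∖ b)| = |A| + |B ∖ b|` and aperiodic sum ((45)), for which the theorem holds
(`conclusion_of_min_card_le_three`) and `card_le_of_conclusion` (the print's KST / Corollary 4.3 step)
is absurd; so every element of `A + B` has exactly two representations (`sum_addConvolution`).  Then the
`d`-component analysis, rendered by counting run-ends `{x : x + d ∉ ·}` and run-starts (their number is
`c_d`, `card_filter_add_notMem`, `card_filter_sub_notMem`) and representations:
`sub_mem_of_add_notMem_terminal` («`|A_i| = 2`»: no `d`-component of `A`, or of `B`, is a single point)
and `false_of_forall_sub_mem_terminal` (the final comparison of end terms).  DEVIATION (bookkeeping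
only): the print argues with the components `A₁, A₂, B₁, B₂` as progressions and their end terms; here
the same end terms are handled through the run-end/run-start sets and the exact representation count
`2`, which avoids materialising the components.

WHAT THIS FILE IS NOT: no new definitions, no named facts; CASE II (infinite `G`) is elsewhere.

## References
* D. J. Grynkiewicz, *A step beyond Kemperman's structure theorem*, Mathematika 55 (2009) 67–114,
  doi:10.1112/S0025579300000966; §6 Subcase 4 pp. 32–34, Lemma 5.9 p. 20, Prop 2.4, Cor 4.3 (held
  `paper:doi-10-1112-s0025579300000966` pp. 32–34; arXiv:0710.1041 pp. 27–28, read 2026-08-29)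
  [cite: Grynkiewicz2009, §6 Subcase 4].
-/

namespace Literature.Combinatorics.Additive

open Finset
open scoped Pointwise

universe u

variable {G : Type u} [AddCommGroup G] [DecidableEq G]

namespace Grynkiewicz2009

/-- `(g + S)ᶜ = g + Sᶜ` in a finite group. [folklore] -/
private theorem compl_vadd_finset₄ [Fintype G] (g : G) (S : Finset G) : (g +ᵥ S)ᶜ = g +ᵥ Sᶜ := by
  ext x
  rw [mem_compl, mem_vadd_finset, mem_vadd_finset]
  constructor
  · intro h
    refine ⟨-g + x, mem_compl.2 fun hx => h ⟨-g + x, hx, by rw [vadd_eq_add, add_neg_cancel_left]⟩, ?_⟩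
    rw [vadd_eq_add, add_neg_cancel_left]
  · rintro ⟨s, hs, rfl⟩ ⟨t, ht, hts⟩
    rw [vadd_eq_add, vadd_eq_add, add_right_inj] at hts
    rw [hts] at ht
    exact mem_compl.1 hs ht

/-- A set that is not quasi-periodic is aperiodic. [cite: Grynkiewicz2009, §2 (`𝒫 ⊆ 𝒬𝒫`)] -/
private theorem addStab_eq_of_not_isQuasiPeriodic {S : Finset G} (hS : S.Nonempty)
    (hqp : ¬ IsQuasiPeriodic S) : S.addStab = {0} := by
  by_contra h
  exact hqp (((isPeriodic_iff_addStab_ne hS).2 h).isQuasiPeriodic hS)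

/-- `d⊆(S, QP) ≥ 2` implies `S` is not quasi-periodic. [cite: Grynkiewicz2009, §2] -/
private theorem not_isQuasiPeriodic_of_two_le {S : Finset G}
    (h : 2 ≤ subsetDist S {P | IsQuasiPeriodic P}) : ¬ IsQuasiPeriodic S := fun hqp => by
  have h0 : subsetDist S {P | IsQuasiPeriodic P} = 0 := subsetDist_eq_zero_iff.2 hqp
  rw [h0] at h
  exact absurd h (by norm_num)

/-! ### «The quasi-period from KST must be `G`»: consequences of (17) and of a decomposition -/

/-- **(17) forces `|G| ≤ |A + B′| + 2`.**  For `G` finite, `0 ∈ A`, `|A|, |B′| ≥ 2`,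
`|A + B′| = |A| + |B′|` with `A + B′` aperiodic, `⟨A⟩ = G`, `d⊆(A, QP) ≥ 2` and `d⊆(A, QAP_d) ≥ 2` for all
`d ≠ 0`: if (17) holds for `(A, B′)` then `|G| ≤ |A + B′| + 2` («Since `⟨A⟩ = G` and `d⊆(A, QP) ≥ 2`, the
quasi-period from KST must be `G`.  Hence, since `d⊆(A, AP) ≥ 2`, … we must have type (III) or (IV)
with `H = G` …», p. 33; contrapositive of `not_seventeen_of_two_le_subsetDist`).
[cite: Grynkiewicz2009, §6 Subcase 4 (p. 33, ¶3)] -/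
theorem card_le_of_seventeen [Fintype G] {A B' : Finset G} (h0A : (0 : G) ∈ A)
    (hA2 : 2 ≤ #A) (hB2 : 2 ≤ #B') (hAB : #(A + B') = #A + #B') (haper : (A + B').addStab = {0})
    (hgen : AddSubgroup.closure (A : Set G) = ⊤)
    (hAqp : 2 ≤ subsetDist A {P | IsQuasiPeriodic P})
    (hAap : ∀ d : G, d ≠ 0 → 2 ≤ subsetDist A {P | IsQuasiProgression d P})
    (h17 : ∃ α β : G, #(insert α A + insert β B') + 1 = #(insert α A) + #(insert β B')) :
    Fintype.card G ≤ #(A + B') + 2 := by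
  by_contra h
  exact not_seventeen_of_two_le_subsetDist h0A hA2 hB2 hAB haper (by omega) hgen hAqp hAap h17

/-- **A one-sided extension is excluded: the pair is non-extendible** («If the pair … is extendible,
then since `d⊆(B, QP) ≥ 2`, since `⟨B⟩ = G`, and since … , it follows in view of KST that
`d⊆(B, AP) ≤ 1`, a contradiction», p. 33 ¶3).  Same data as `card_le_of_seventeen` with
`|A + B′| + 2 ≤ |G|`: an extension of either set keeping the sumset is a critical pair `(A″, B″)` with
`A ⊆ A″`, `|A″ ∖ A| ≤ 1`, aperiodic sumset and `|A″| + |B″| = |A + B′| + 1 < |G|`; KST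
(`exists_isKempermanDecompI_of_not_isPeriodic'`) has quasi-period `G`
(`IsKempermanDecompI.alternatives_of_top`): type (I) contradicts the sizes, type (II) makes `A″` a
progression (`d⊆(A, QAP_d) ≤ 1`), types (III)/(IV) need `|G| ≤ |A″| + |B″|`.
[cite: Grynkiewicz2009, §6 Subcase 4 (p. 33, ¶3)] -/
theorem isNonExtendible_of_two_le_subsetDist [Fintype G] {A B' : Finset G} (h0A : (0 : G) ∈ A)
    (hA2 : 2 ≤ #A) (hB2 : 2 ≤ #B') (hAB : #(A + B') = #A + #B') (haper : (A + B').addStab = {0})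
    (hG : #(A + B') + 2 ≤ Fintype.card G) (hgen : AddSubgroup.closure (A : Set G) = ⊤)
    (hAqp : 2 ≤ subsetDist A {P | IsQuasiPeriodic P})
    (hAap : ∀ d : G, d ≠ 0 → 2 ≤ subsetDist A {P | IsQuasiProgression d P}) :
    IsNonExtendible A B' ∧ IsNonExtendible B' A := by
  have hAne : A.Nonempty := card_pos.1 (by omega)
  have hBne : B'.Nonempty := card_pos.1 (by omega)
  haveI : Nontrivial G := by
    rw [← Fintype.one_lt_card_iff_nontrivial]
    exact lt_of_lt_of_le (by omega : 1 < #A) (card_le_univ A)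
  have key : ∀ {A'' B'' : Finset G}, A ⊆ A'' → #(A'' \ A) ≤ 1 → B' ⊆ B'' →
      #(A'' + B'') + 1 = #A'' + #B'' → (A'' + B'').addStab = {0} →
      #A'' + #B'' = #(A + B') + 1 → False := by
    intro A'' B'' hAA hA1 hBB hcrit hap hsize
    have hA''ne : A''.Nonempty := hAne.mono hAA
    have hB''ne : B''.Nonempty := hBne.mono hBB
    have hA''2 : 2 ≤ #A'' := hA2.trans (card_le_card hAA)
    have hB''2 : 2 ≤ #B'' := hB2.trans (card_le_card hBB)
    have hnp : ¬ IsPeriodic (A'' + B'') := fun h =>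
      (isPeriodic_iff_addStab_ne (hA''ne.add hB''ne)).1 h hap
    obtain ⟨L, A₁, A₀, B₁, B₀, hK⟩ :=
      exists_isKempermanDecompI_of_not_isPeriodic' hA''ne hB''ne hcrit.le hnp
    rcases hK.alternatives_of_top hAA hA1 h0A hgen hAqp with hI | ⟨d, hAd, -, hord⟩ | hbig
    · omega
    · have hd : d ≠ 0 := hAd.ne_zero (by omega)
      obtain ⟨a, hAeq⟩ := hAd
      have hqp : IsQuasiProgression d A'' := by
        rw [hAeq]
        refine isQuasiProgression_apFinset (by omega) (card_apFinset_of_addOrderOf a d ?_)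
        rcases hord with h0 | hle'
        · exact Or.inl h0
        · exact Or.inr (by omega)
      have h := (hAap d hd).trans (subsetDist_le (𝒮 := {P | IsQuasiProgression d P}) hqp hAA)
      norm_cast at h
      omega
    · omega
  constructor
  · intro a ha hext
    refine key (subset_insert a A) ?_ Subset.rfl ?_ (by rw [hext]; exact haper) ?_
    · rw [insert_sdiff_of_notMem A ha, Finset.sdiff_self, Finset.insert_empty, card_singleton]
    · rw [hext, hAB, card_insert_of_notMem ha]; omega
    · rw [card_insert_of_notMem ha, hAB]; omega
  · intro b hb hext
    rw [add_comm (insert b B') A, add_comm B' A] at hext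
    refine key Subset.rfl (by rw [Finset.sdiff_self, card_empty]; omega)
      (subset_insert b B') ?_ (by rw [hext]; exact haper) ?_
    · rw [hext, hAB, card_insert_of_notMem hb]; omega
    · rw [card_insert_of_notMem hb, hAB]; omega

/-- **The decomposition alternative has `H = G` and then type (VII) with `|Y| = 3`.**  If the second
alternative of Theorem 4.1 holds for `(X, Y)` with `0 ∈ X`, `⟨X⟩ = G`, `d⊆(X, QP) ≥ 2`, `|X| ≥ 4`,
`|Y| ≥ 3`, then (`H = G` by `IsGrynkiewiczDecomp.eq_top_of_not_isQuasiPeriodic`; «we cannot have type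
(V)–(VII) … Since `d⊆(·, QP) ≥ 2`, we cannot have type (VIII)», p. 33) the pair is the large member of a
type (VII) dual: `|Y| = 3` and `|G| = |X| + 6`. [cite: Grynkiewicz2009, §6 Subcase 4 (p. 33, ¶3)] -/
theorem card_eq_of_isGrynkiewiczDecomp [Fintype G] {K : AddSubgroup G} {X Y X₁ X₀ Y₁ Y₀ : Finset G}
    (hD : IsGrynkiewiczDecomp K X Y X₁ X₀ Y₁ Y₀) (h0X : (0 : G) ∈ X)
    (hgenX : AddSubgroup.closure (X : Set G) = ⊤) (h47X : 2 ≤ subsetDist X {P | IsQuasiPeriodic P})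
    (hX4 : 4 ≤ #X) (hY3 : 3 ≤ #Y) : #Y = 3 ∧ Fintype.card G = #X + 6 := by
  classical
  have hXqp : ¬ IsQuasiPeriodic X := not_isQuasiPeriodic_of_two_le h47X
  obtain ⟨hK, -, hX₀, -, hY₀⟩ := hD.eq_top_of_not_isQuasiPeriodic h0X hgenX hXqp
  subst hK
  have hbot := hD.bottom
  rw [hX₀, hY₀] at hbot
  rcases hbot with hV | hVI | hVII | hVIII
  · have := hV.1
    omega
  · have := hVI.1
    omega
  · obtain ⟨K', A'', B'', -, hVI'', hdual⟩ := hVII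
    have h6 : #(A'' + B'') = 6 := by rw [hVI''.card_add, hVI''.1, hVI''.2.1]
    have h6le : #(A'' + B'') ≤ Fintype.card G := card_le_univ _
    obtain ⟨a, -, c, -, -, -, -, -, hcases⟩ := hdual
    rcases hcases with ⟨g, g', hXg, -⟩ | ⟨g, g', hYg, hXiff⟩
    · have : #X = 3 := by rw [hXg, card_vadd_finset, card_neg, hVI''.1]
      omega
    · have hK'top : K' = ⊤ := by
        refine eq_top_of_coset_of_closure_eq_top (a := g' + (a + c)) h0X hgenX fun y hy => ?_
        have := ((hXiff y).1 hy).1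
        rwa [sub_sub] at this
      subst hK'top
      have hXeq2 : X = g' +ᵥ (A'' + B'')ᶜ := by
        ext z
        rw [hXiff z, mem_vadd_finset]
        constructor
        · rintro ⟨-, hz⟩
          exact ⟨z - g', mem_compl.2 hz, by rw [vadd_eq_add]; abel⟩
        · rintro ⟨y, hy, rfl⟩
          refine ⟨AddSubgroup.mem_top _, ?_⟩
          rw [vadd_eq_add, add_sub_cancel_left]
          exact mem_compl.1 hy
      have hXc2 : #X = Fintype.card G - 6 := by rw [hXeq2, card_vadd_finset, card_compl, h6]
      have hYc : #Y = 3 := by rw [hYg, card_vadd_finset, card_neg, hVI''.2.1]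
      exact ⟨hYc, by omega⟩
  · have h1 := hVIII.subsetDist_isQuasiPeriodic_le_one_left
    have : (2 : ℕ∞) ≤ 1 := h47X.trans h1
    exact absurd this (by norm_num)

/-- **The theorem for `(X, Y)` with `X` «strongly non-degenerate» bounds `|G|`**: for `0 ∈ X`,
`|X| ≥ 4`, `|Y| ≥ 3`, `|X + Y| = |X| + |Y|`, `X + Y` aperiodic, `⟨X⟩ = G`, `d⊆(X, QP) ≥ 2`,
`d⊆(X, QAP_d) ≥ 2` (`d ≠ 0`), the conclusion of Theorem 4.1 for `(X, Y)` gives `|G| ≤ |X + Y| + 2`, or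
`|Y| = 3` and `|G| = |X| + 6` (`card_le_of_seventeen`, `card_eq_of_isGrynkiewiczDecomp`; the print's uses of
Corollary 4.3 on pp. 33–34 are instances). [cite: Grynkiewicz2009, §6 Subcase 4 (p. 33)] -/
theorem card_le_of_conclusion [Fintype G] {X Y : Finset G} (h0X : (0 : G) ∈ X) (hX4 : 4 ≤ #X)
    (hY3 : 3 ≤ #Y) (hXY : #(X + Y) = #X + #Y) (haper : (X + Y).addStab = {0})
    (hgenX : AddSubgroup.closure (X : Set G) = ⊤) (h47X : 2 ≤ subsetDist X {P | IsQuasiPeriodic P})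
    (h50X : ∀ d : G, d ≠ 0 → 2 ≤ subsetDist X {P | IsQuasiProgression d P})
    (hconcl : ((∃ α β : G, #(insert α X + insert β Y) + 1 = #(insert α X) + #(insert β Y)) ∨
        ∃ (K : AddSubgroup G) (X₁ X₀ Y₁ Y₀ : Finset G), IsGrynkiewiczDecomp K X Y X₁ X₀ Y₁ Y₀)) :
    Fintype.card G ≤ #(X + Y) + 2 ∨ (#Y = 3 ∧ Fintype.card G = #X + 6) := by
  rcases hconcl with h17 | ⟨K, X₁, X₀, Y₁, Y₀, hD⟩
  · exact Or.inl (card_le_of_seventeen h0X (by omega) (by omega) hXY haper hgenX h47X h50X h17)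
  · exact Or.inr (card_eq_of_isGrynkiewiczDecomp hD h0X hgenX h47X hX4 hY3)

/-! ### Subcase 4, ¶1–¶4 -/

/-- **§6 Subcase 4, reduced to the terminal `4 × 4` configuration** (print pp. 32–33; see the module
docstring for the paragraph-by-paragraph account).  Hypotheses: the standing data of the deep core for
`(A, B)` with `|A| ≥ |B| ≥ 4` and `|\overline{A + B}| ≥ 4`, a maximal `e ∈ A − B` with `|B(e)| = 2` and
`A(e) + B(e)` aperiodic, the printed induction hypothesis `IH`, and `terminal`: «the case with
`|A| = |B| = 4` and `c_d(A) = c_d(B) = c_d(A + B) = 2`» (with its Claims 4, 8, 10, (45), (47), (50), (51)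
data) is contradictory.  Conclusion: contradiction. [cite: Grynkiewicz2009, §6 Subcase 4 (pp. 32–33)] -/
theorem subcaseFour_false_of_terminal [Fintype G]
    (terminal : ∀ (A B : Finset G) (d : G), (0 : G) ∈ A → (0 : G) ∈ B → #A = 4 → #B = 4 →
        #(A + B) = #A + #B → ¬ IsQuasiPeriodic (A + B) → AddSubgroup.closure (A : Set G) = ⊤ →
        2 ≤ subsetDist A {P | IsQuasiPeriodic P} →
        (∀ f : G, f ≠ 0 → 2 ≤ subsetDist A {P | IsQuasiProgression f P}) →
        2 ≤ subsetDist B {P | IsQuasiPeriodic P} →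
        (∀ b ∈ B, #(layerWith A B 1 {b}) ≤ 1) → 4 ≤ #(A + B)ᶜ → d ≠ 0 →
        componentCount d A = 2 → componentCount d B = 2 → componentCount d (A + B) = 2 →
        2 ≤ subsetDist B {P | IsQuasiProgression d P} → False)
    {A B : Finset G} {e : G} (h0A : (0 : G) ∈ A) (h0B : (0 : G) ∈ B) (hBA : #B ≤ #A) (hB4 : 4 ≤ #B)
    (hAB : #(A + B) = #A + #B) (haper : (A + B).addStab = {0})
    (hP3 : ∀ P : Finset G, A + B ⊆ P → P.addStab ≠ {0} → 3 ≤ #(P \ (A + B)))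
    (hneA : IsNonExtendible A B) (hneB : IsNonExtendible B A)
    (hAqp : ¬ IsQuasiPeriodic A) (hBqp : ¬ IsQuasiPeriodic B)
    (hgenA : AddSubgroup.closure (A : Set G) = ⊤) (hgenB : AddSubgroup.closure (B : Set G) = ⊤)
    (h47A : 2 ≤ subsetDist A {P | IsQuasiPeriodic P}) (h47B : 2 ≤ subsetDist B {P | IsQuasiPeriodic P})
    (h48A : ∀ P : Finset G, Aᶜ ⊆ P → P.addStab ≠ {0} → 3 ≤ #(P \ Aᶜ))
    (h48B : ∀ P : Finset G, Bᶜ ⊆ P → P.addStab ≠ {0} → 3 ≤ #(P \ Bᶜ))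
    (h49 : 2 ≤ subsetDist (A + B)ᶜ {P | IsQuasiPeriodic P})
    (h50A : ∀ d : G, d ≠ 0 → 2 ≤ subsetDist A {P | IsQuasiProgression d P})
    (h50B : ∀ d : G, d ≠ 0 → 2 ≤ subsetDist B {P | IsQuasiProgression d P})
    (h51 : ∀ d : G, d ≠ 0 → 2 ≤ subsetDist (A + B)ᶜ {P | IsQuasiProgression d P})
    (hN1B : ∀ b ∈ B, #(layerWith A B 1 {b}) ≤ 1)
    (hC4 : 4 ≤ #(A + B)ᶜ) (hY2 : #((e +ᵥ B) ∩ A) = 2)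
    (haper_e : (((e +ᵥ B) ∪ A) + ((e +ᵥ B) ∩ A)).addStab = {0})
    (IH : (∀ X Y : Finset G, (0 : G) ∈ X → (0 : G) ∈ Y → 3 ≤ #X → 3 ≤ #Y → #(X + Y) = #X + #Y →
        (X + Y).addStab = {0} →
        (∀ P : Finset G, X + Y ⊆ P → P.addStab ≠ {0} → 2 ≤ #(P \ (X + Y))) →
        IsNonExtendible X Y → IsNonExtendible Y X → ¬ IsQuasiPeriodic X → ¬ IsQuasiPeriodic Y →
        AddSubgroup.closure (X : Set G) = ⊤ → AddSubgroup.closure (Y : Set G) = ⊤ →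
        (min #X #Y < #B ∨ (min #X #Y = #B ∧ #A + #B < #X + #Y)) →
        ((∃ α β : G, #(insert α X + insert β Y) + 1 = #(insert α X) + #(insert β Y)) ∨
          ∃ (K : AddSubgroup G) (X₁ X₀ Y₁ Y₀ : Finset G), IsGrynkiewiczDecomp K X Y X₁ X₀ Y₁ Y₀))) :
    False := by
  classical
  have hA4 : 4 ≤ #A := by omega
  have hA3 : 3 ≤ #A := by omega
  have hB3 : 3 ≤ #B := by omega
  have hC3 : 3 ≤ #(A + B)ᶜ := by omega
  have hAne : A.Nonempty := ⟨0, h0A⟩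
  have hBne : B.Nonempty := ⟨0, h0B⟩
  have hcardG : #(A + B) + #(A + B)ᶜ = Fintype.card G := by
    rw [card_compl]; have := card_le_univ (A + B); omega
  have hAc : #Aᶜ = Fintype.card G - #A := card_compl _
  have hBc : #Bᶜ = Fintype.card G - #B := card_compl _
  have hAcne : (Aᶜ : Finset G).Nonempty := card_pos.1 (by omega)
  have hBcne : (Bᶜ : Finset G).Nonempty := card_pos.1 (by omega)
  have hstA : A.addStab = {0} := addStab_eq_of_not_isQuasiPeriodic hAne hAqp
  have hstB : B.addStab = {0} := addStab_eq_of_not_isQuasiPeriodic hBne hBqp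
  obtain ⟨h45, h45c, h46⟩ :=
    not_isQuasiPeriodic_add_and_compl hA3 hC3 h0A h0B hAB haper hneA hneB hgenA hAqp
  /- ¶1: `(A(e), B(e))` is critical, `B(e) = {y, y + d}`, `c_d(A(e)) = 2` -/
  set X₀ : Finset G := (e +ᵥ B) ∪ A with hX₀
  set Y₀ : Finset G := (e +ᵥ B) ∩ A with hY₀
  obtain ⟨hXY₀, hsum₀, -, -⟩ :=
    eTransform_card_add_eq_and_isNonExtendible (X := X₀) (Y := Y₀) h0A hgenA (by omega) hAB hC3 h46
      h49 h51 (by rw [hX₀]; exact subset_union_right) (eTransform_add_subset A B e)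
      (card_eTransform A B e) (by omega) haper_e
  obtain ⟨y, y', hyne, hYeq⟩ := card_eq_two.1 hY2
  set d : G := y' - y with hd
  have hd0 : d ≠ 0 := fun h => hyne (by rw [hd, sub_eq_zero] at h; exact h.symm)
  have hYpair : Y₀ = y +ᵥ ({0, d} : Finset G) := by
    rw [hYeq, vadd_finset_insert, vadd_finset_singleton, vadd_eq_add, vadd_eq_add, add_zero, hd,
      add_sub_cancel]
  have hXYpair : X₀ + Y₀ = y +ᵥ (X₀ + {0, d}) := by
    rw [hYpair, add_comm X₀, vadd_add_assoc, add_comm _ X₀]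
  have hcX₀ : componentCount d X₀ = 2 := by
    have h1 := card_add_pair_zero d X₀
    have h2 : #(X₀ + Y₀) = #(X₀ + {0, d}) := by rw [hXYpair, card_vadd_finset]
    rw [hY2] at hXY₀
    omega
  -- `c_d(A + B) = c_d(\overline{A + B}) ≤ 2`, hence `= 2`
  have hABeq : A + B = (-e + y) +ᵥ (X₀ + {0, d}) := by
    rw [← vadd_vadd, ← hXYpair, hsum₀, neg_vadd_vadd]
  have hcAB_le : componentCount d (A + B) ≤ 2 := by
    rw [hABeq, componentCount_vadd]
    exact (componentCount_add_pair_zero_le d X₀).trans hcX₀.le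
  have two_of : ∀ {S : Finset G}, S.Nonempty → ¬ IsQuasiPeriodic S →
      2 ≤ subsetDist S {P | IsQuasiProgression d P} → componentCount d S ≤ 2 →
      componentCount d S = 2 := by
    intro S hSne hSqp hS50 hle
    rcases (by omega : componentCount d S = 0 ∨ componentCount d S = 1 ∨ componentCount d S = 2) with
      h0 | h1 | h2
    · exfalso
      have hinv := componentCount_eq_zero_iff.1 h0
      have hst : S.addStab ≠ {0} := by
        intro hst
        have hmem : d ∈ S.addStab := (mem_addStab hSne).2 hinv
        rw [hst, mem_singleton] at hmem
        exact hd0 hmem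
      exact hSqp (((isPeriodic_iff_addStab_ne hSne).2 hst).isQuasiPeriodic hSne)
    · exfalso
      have h0 : subsetDist S {P | IsQuasiProgression d P} = 0 :=
        subsetDist_eq_zero_iff.2 (show IsQuasiProgression d S from h1)
      rw [h0] at hS50
      exact absurd hS50 (by norm_num)
    · exact h2
  have hCne : ((A + B)ᶜ : Finset G).Nonempty := card_pos.1 (by omega)
  have hcC : componentCount d (A + B)ᶜ = 2 :=
    two_of hCne h45c (h51 d hd0) (by rw [componentCount_compl]; exact hcAB_le)
  have hcAB : componentCount d (A + B) = 2 := by rw [← componentCount_compl]; exact hcC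
  -- Lemma 5.9 for the pair `(−γ + \overline{A + B}, −B)`
  obtain ⟨γ, hγ⟩ := hCne
  set P : Finset G := (-γ) +ᵥ (A + B)ᶜ with hP
  set Q : Finset G := -B with hQ
  have h0P : (0 : G) ∈ P := mem_vadd_finset.2 ⟨γ, hγ, by rw [vadd_eq_add, neg_add_cancel]⟩
  have h0Q : (0 : G) ∈ Q := by rw [hQ, mem_neg', neg_zero]; exact h0B
  have hcardP : #P = #(A + B)ᶜ := by rw [hP, card_vadd_finset]
  have hcardQ : #Q = #B := by rw [hQ, card_neg]
  obtain ⟨hsumBC, hne1, hne2⟩ := isNonExtendible_pair_neg_compl' hneA hneB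
  have hPQ : P + Q = (-γ) +ᵥ Aᶜ := by
    rw [hP, hQ, vadd_add_assoc, add_comm (A + B)ᶜ (-B), hsumBC]
  have hcPQ : #(P + Q) = #P + #Q := by
    rw [hPQ, card_vadd_finset, hAc, hcardP, hcardQ]; omega
  have hP3' : ∀ R : Finset G, P + Q ⊆ R → R.addStab ≠ {0} → 3 ≤ #(R \ (P + Q)) := by
    rw [hPQ]; exact forall_card_sdiff_vadd _ h48A
  have hnePQ : IsNonExtendible P Q := by rw [hP, hQ]; exact hne2.vadd_left (-γ)
  have hneQP : IsNonExtendible Q P := by rw [hP, hQ]; exact hne1.vadd_right (-γ)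
  have hgenP : AddSubgroup.closure (P : Set G) = ⊤ := by rw [hP]; exact h46 γ hγ
  have hPqp : ¬ IsQuasiPeriodic P := by rw [hP, isQuasiPeriodic_vadd_iff]; exact h45c
  have hcP : componentCount d P = 2 := by rw [hP, componentCount_vadd]; exact hcC
  have h47P : 2 ≤ subsetDist P {R | IsQuasiPeriodic R} := by
    rw [hP, subsetDist_vadd_eq _ (fun R => isQuasiPeriodic_vadd_iff _)]; exact h49
  have h50P : 2 ≤ subsetDist P {R | IsQuasiProgression d R} := by
    rw [hP, subsetDist_vadd_eq _ (fun R => isQuasiProgression_vadd_iff)]; exact h51 d hd0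
  have hQqp : ¬ IsQuasiPeriodic Q := by rw [hQ, isQuasiPeriodic_neg_iff]; exact hBqp
  have hgenQ : AddSubgroup.closure (Q : Set G) = ⊤ := by
    rw [hQ, coe_neg, AddSubgroup.closure_neg]; exact hgenB
  have h47Q : 2 ≤ subsetDist Q {R | IsQuasiPeriodic R} := by
    rw [hQ, subsetDist_neg_eq (fun R => isQuasiPeriodic_neg_iff)]; exact h47B
  have h50Q : ∀ f : G, f ≠ 0 → 2 ≤ subsetDist Q {R | IsQuasiProgression f R} := fun f hf => by
    rw [hQ, subsetDist_neg_eq (fun R => isQuasiProgression_neg_iff)]; exact h50B f hf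
  rcases componentCount_le_two_or_seventeen_of_componentCount_eq_two (by omega) (by omega) h0P h0Q
    hcPQ hP3' hnePQ hneQP hgenP hPqp hd0 hcP with ⟨hcQle, hcPQle⟩ | ⟨-, hbad⟩
  swap
  · rcases hbad with hall | hAP0
    · have hmem : (P + Q)ᶜ ∈ ({P, Q, P + Q, Pᶜ, Qᶜ, (P + Q)ᶜ} : Finset (Finset G)) := by simp
      have h1 := hall _ hmem
      have hPQc : (P + Q)ᶜ = (-γ) +ᵥ A := by rw [hPQ, compl_vadd_finset₄, compl_compl]
      rw [hPQc, subsetDist_vadd_eq _ (fun R => isQuasiPeriodic_vadd_iff _)] at h1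
      rw [h1] at h47A
      exact absurd h47A (by norm_num)
    · obtain ⟨f, hf0, hQap⟩ :
          Q ∈ {R : Finset G | ∃ f : G, f ≠ 0 ∧ IsAP R f} := subsetDist_eq_zero_iff.1 hAP0
      have hQqprog : IsQuasiProgression f Q :=
        isQuasiProgression_of_isAP hQap ⟨0, h0Q⟩ (by rw [hQ, addStab_neg]; exact hstB) hf0
      have h0 : subsetDist Q {R | IsQuasiProgression f R} = 0 := subsetDist_eq_zero_iff.2 hQqprog
      have h2 := h50Q f hf0
      rw [h0] at h2
      exact absurd h2 (by norm_num)
  have hcB : componentCount d B = 2 :=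
    two_of hBne hBqp (h50B d hd0) (by rw [hQ, componentCount_neg] at hcQle; exact hcQle)
  have hcA : componentCount d A = 2 :=
    two_of hAne hAqp (h50A d hd0)
      (by rw [hPQ, componentCount_vadd, componentCount_compl] at hcPQle; exact hcPQle)
  /- ¶2: (61) `d⊆(A + B + {0, d}, 𝒫) ≥ 2` -/
  set A' : Finset G := A + {0, d} with hA'
  have hcardA' : #A' = #A + 2 := by rw [hA', card_add_pair_zero, hcA]
  have hsumA' : A' + B = A + B + {0, d} := by rw [hA', add_right_comm]
  have hcardA'B : #(A' + B) = #(A + B) + 2 := by rw [hsumA', card_add_pair_zero, hcAB]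
  have hcritA' : #(A' + B) = #A' + #B := by omega
  have hBA'card : #(B + A') = #(A + B) + 2 := by rw [add_comm B A', hcardA'B]
  have hBA' : #(B + A') = #B + #A' := by rw [add_comm, hcritA', add_comm]
  have h2B : 2 ≤ #B := by omega
  have h2A' : 2 ≤ #A' := by omega
  have h3A' : 3 ≤ #A' := by omega
  have h6A' : 6 ≤ #A' := by omega
  have hsubAB : A + B ⊆ A' + B := by
    rw [hsumA']; exact subset_add_left _ (mem_insert_self 0 _)
  have h0A' : (0 : G) ∈ A' := by
    have := add_mem_add h0A (mem_insert_self (0 : G) {d})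
    rwa [add_zero] at this
  have hap' : (A' + B).addStab = {0} := by
    by_contra hst
    have h3 := hP3 (A' + B) hsubAB hst
    rw [card_sdiff_of_subset hsubAB, hcardA'B] at h3
    omega
  have h61 : ∀ R : Finset G, A' + B ⊆ R → R.addStab ≠ {0} → 2 ≤ #(R \ (A' + B)) := by
    intro R hR hRst
    have h3 := hP3 R (hsubAB.trans hR) hRst
    have hRle : #R ≤ Fintype.card G := card_le_univ R
    have e1 : #(R \ (A' + B)) + 2 = #(R \ (A + B)) := by
      rw [card_sdiff_of_subset hR, card_sdiff_of_subset (hsubAB.trans hR), hcardA'B]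
      have := card_le_card hR; omega
    by_contra hlt
    have h1 : #(R \ (A' + B)) = 1 := by omega
    obtain ⟨γ', hγ'⟩ := card_eq_one.1 h1
    have hγ'mem : γ' ∈ R \ (A' + B) := by rw [hγ']; exact mem_singleton_self _
    rw [mem_sdiff] at hγ'mem
    have hReq : R = insert γ' (A' + B) := by
      rw [insert_eq, ← hγ', sdiff_union_of_subset hR]
    by_cases hC5 : 5 ≤ #(A + B)ᶜ
    · -- Claim 2 gives (17) for `(B, A + {0, d})`, excluded for `B`
      have hG3 : #(B + A') + 3 ≤ Fintype.card G := by rw [hBA'card]; omega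
      have hapBA' : (B + A').addStab = {0} := by rw [add_comm]; exact hap'
      have h17 : ∃ α β : G, #(insert α B + insert β A') + 1 = #(insert α B) + #(insert β A') :=
        seventeen_of_addStab_insert_ne (A := B) (B := A') (by rw [add_comm]; exact hγ'mem.2) hBA'
          (by rw [add_comm B A', ← hReq]; exact hRst)
      exact not_seventeen_of_two_le_subsetDist h0B h2B h2A' hBA' hapBA' hG3 hgenB h47B h50B h17
    · -- `|\overline{A + B}| = 4`: `R = G ∖ {pt}` is not periodic
      have hRcard : #R + 1 = Fintype.card G := by
        rw [hReq, card_insert_of_notMem hγ'mem.2, hcardA'B]; omega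
      have hRne : R.Nonempty := ⟨γ', hγ'mem.1⟩
      obtain ⟨h, hh, hh0⟩ : ∃ h ∈ R.addStab, h ≠ (0 : G) := by
        by_contra hno
        push Not at hno
        exact hRst (Subset.antisymm (fun x hx => mem_singleton.2 (hno x hx))
          (singleton_subset_iff.2 hRne.zero_mem_addStab))
      have hRc1 : #Rᶜ = 1 := by rw [card_compl]; omega
      obtain ⟨z, hz⟩ := card_eq_one.1 hRc1
      have hhR : h +ᵥ R = R := (mem_addStab hRne).1 hh
      have hzR : z ∉ R := by rw [← mem_compl, hz]; exact mem_singleton_self z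
      have hhz : h + z ∈ Rᶜ := by
        rw [mem_compl]
        intro hmem
        rw [← hhR] at hmem
        obtain ⟨w, hw, hwz⟩ := mem_vadd_finset.1 hmem
        rw [vadd_eq_add, add_right_inj] at hwz
        rw [hwz] at hw
        exact hzR hw
      rw [hz, mem_singleton] at hhz
      exact hh0 (add_eq_right.1 hhz)
  /- ¶3: the induction hypothesis for `(A + {0, d}, B)` gives `|\overline{A + B}| = 4` -/
  have hapBA' : (B + A').addStab = {0} := by rw [add_comm]; exact hap'
  have hG2 : #(B + A') + 2 ≤ Fintype.card G := by rw [hBA'card]; omega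
  obtain ⟨hneBA', hneA'B⟩ := isNonExtendible_of_two_le_subsetDist (A := B) (B' := A') h0B h2B h2A'
    hBA' hapBA' hG2 hgenB h47B h50B
  obtain ⟨hA'qp, hgenA'⟩ := not_isQuasiPeriodic_and_closure_eq_top hB3 h3A' h0B h0A' hBA' hapBA'
    hneBA' hneA'B hgenB hBqp
  have hminA' : min #A' #B = #B := Nat.min_eq_right (by omega)
  have hsumlt : #A + #B < #A' + #B := by omega
  have hconcl := IH A' B h0A' h0B h3A' hB3 hcritA' hap' h61 hneA'B hneBA' hA'qp hBqp hgenA' hgenB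
    (Or.inr ⟨hminA', hsumlt⟩)
  have hbound := card_le_of_conclusion h0B hB4 h3A' hBA' hapBA' hgenB h47B h50B (conclusion_symm hconcl)
  clear hconcl
  have hC4eq : #(A + B)ᶜ = 4 := by
    rcases hbound with hle | ⟨h3, -⟩
    · rw [hBA'card] at hle; omega
    · omega
  clear hbound
  /- ¶4: `|B| = 4` (for `|B| ≥ 5` the induction hypothesis for `(−A, −γ + \overline{A + B})` and
  `card_le_of_conclusion` contradict) -/
  have hB4eq : #B = 4 := by
    by_contra hB5
    have hB5 : 5 ≤ #B := by omega
    obtain ⟨hsumAC, hne3, hne4⟩ := isNonExtendible_pair_neg_compl hneA hneB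
    set X : Finset G := -A with hX
    have hXP : X + P = (-γ) +ᵥ Bᶜ := by
      rw [hX, hP, add_comm, vadd_add_assoc, add_comm (A + B)ᶜ (-A), hsumAC]
    have hcardX : #X = #A := by rw [hX, card_neg]
    have hcXP : #(X + P) = #X + #P := by
      rw [hXP, card_vadd_finset, hBc, hcardP, hcardX]; omega
    have h0X : (0 : G) ∈ X := by rw [hX, mem_neg', neg_zero]; exact h0A
    have hapXP : (X + P).addStab = {0} := by
      rw [hXP, addStab_vadd, addStab_compl hBne hBcne, hstB]
    have hP2XP : ∀ R : Finset G, X + P ⊆ R → R.addStab ≠ {0} → 2 ≤ #(R \ (X + P)) := by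
      intro R hR hst
      have := forall_card_sdiff_vadd (-γ) h48B R (by rw [← hXP]; exact hR) hst
      rw [← hXP] at this
      omega
    have hneXP : IsNonExtendible X P := by rw [hX, hP]; exact hne3.vadd_right (-γ)
    have hnePX : IsNonExtendible P X := by rw [hX, hP]; exact hne4.vadd_left (-γ)
    have hXqp : ¬ IsQuasiPeriodic X := by rw [hX, isQuasiPeriodic_neg_iff]; exact hAqp
    have hgenX : AddSubgroup.closure (X : Set G) = ⊤ := by
      rw [hX, coe_neg, AddSubgroup.closure_neg]; exact hgenA
    have h47X : 2 ≤ subsetDist X {R | IsQuasiPeriodic R} := by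
      rw [hX, subsetDist_neg_eq (fun R => isQuasiPeriodic_neg_iff)]; exact h47A
    have h50X : ∀ f : G, f ≠ 0 → 2 ≤ subsetDist X {R | IsQuasiProgression f R} := fun f hf => by
      rw [hX, subsetDist_neg_eq (fun R => isQuasiProgression_neg_iff)]; exact h50A f hf
    have h3X : 3 ≤ #X := by omega
    have h4X : 4 ≤ #X := by omega
    have h3P : 3 ≤ #P := by omega
    have hminlt : min #X #P < #B := lt_of_le_of_lt (Nat.min_le_right _ _) (by omega)
    have hconclX := IH X P h0X h0P h3X h3P hcXP hapXP hP2XP hneXP hnePX hXqp hPqp hgenX hgenP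
      (Or.inl hminlt)
    have hbound := card_le_of_conclusion h0X h4X h3P hcXP hapXP hgenX h47X h50X hconclX
    clear hconclX
    rcases hbound with hle' | ⟨h3, -⟩
    · rw [hXP, card_vadd_finset, hBc] at hle'; omega
    · omega
  /- the terminal configuration: `(A, B)` if `|A| = 4`, else `(−B, −γ + \overline{A + B})` -/
  by_cases hA4eq : #A = 4
  · exact terminal A B d h0A h0B hA4eq hB4eq hAB h45 hgenA h47A h50A h47B hN1B hC4 hd0 hcA hcB hcAB
      (h50B d hd0)
  · -- the pair `(Q, P) = (−B, −γ + \overline{A + B})`, with sumset `−γ + \overline{A}`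
    have hQP : Q + P = (-γ) +ᵥ Aᶜ := by rw [add_comm, hPQ]
    have hcQP : #(Q + P) = #Q + #P := by rw [add_comm, hcPQ, add_comm]
    have hapQP : (Q + P).addStab = {0} := by
      rw [hQP, addStab_vadd, addStab_compl hAne hAcne, hstA]
    have hQPc : (Q + P)ᶜ = (-γ) +ᵥ A := by rw [hQP, compl_vadd_finset₄, compl_compl]
    have hcardQPc : #(Q + P)ᶜ = #A := by rw [hQPc, card_vadd_finset]
    obtain ⟨h45', -, -⟩ := not_isQuasiPeriodic_add_and_compl (A := Q) (B := P) (by omega)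
      (by rw [hcardQPc]; exact hA3) h0Q h0P hcQP hapQP hneQP hnePQ hgenQ hQqp
    -- Claim 8 for `(Q, P)`; its (17) alternative is excluded by `card_le_of_seventeen`
    have h3Q : 3 ≤ #Q := by omega
    have h3P : 3 ≤ #P := by omega
    have h2Q : 2 ≤ #Q := by omega
    have h2P : 2 ≤ #P := by omega
    have h5A : 5 ≤ #A := by omega
    have hN1P : ∀ p ∈ P, #(layerWith Q P 1 {p}) ≤ 1 := by
      rcases card_layerWith_le_one_and_or_seventeen h0Q h0P h3Q h3P hcQP hapQP hneQP hnePQ hgenQ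
        hgenP hQqp hPqp with ⟨hN1, -⟩ | h17
      · exact hN1
      · exfalso
        have hle := card_le_of_seventeen h0Q h2Q h2P hcQP hapQP hgenQ h47Q h50Q h17
        clear h17
        rw [hQP, card_vadd_finset, hAc] at hle
        omega
    have hcQ : componentCount d Q = 2 := by rw [hQ, componentCount_neg]; exact hcB
    have hcQP' : componentCount d (Q + P) = 2 := by
      rw [hQP, componentCount_vadd, componentCount_compl]; exact hcA
    exact terminal Q P d h0Q h0P (by omega) (by omega) hcQP h45' hgenQ h47Q h50Q h47P hN1P
      (by rw [hcardQPc]; exact hA4) hd0 hcQ hcP hcQP' h50P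

/-! ### The terminal configuration: `|A| = |B| = 4`, `c_d(A) = c_d(B) = c_d(A + B) = 2` -/

/-- The number of `d`-run-ends `{s ∈ S : s + d ∉ S}` of `S` is `c_d(S)` («the end terms of the
`d`-components»). [cite: Grynkiewicz2009, §2 (`c_d(A) = |A + {0,d}| − |A|`)] -/
theorem card_filter_add_notMem (d : G) (S : Finset G) :
    #(S.filter fun s => s + d ∉ S) = componentCount d S := by
  rw [componentCount_eq_card_vadd_sdiff]
  refine card_nbij' (fun s => s + d) (fun x => x - d) ?_ ?_ ?_ ?_
  · intro s hs
    rw [mem_coe, mem_filter] at hs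
    rw [mem_coe, mem_sdiff]
    exact ⟨mem_vadd_finset.2 ⟨s, hs.1, by rw [vadd_eq_add, add_comm]⟩, hs.2⟩
  · intro x hx
    rw [mem_coe, mem_sdiff, mem_vadd_finset] at hx
    obtain ⟨⟨s, hs, rfl⟩, hx2⟩ := hx
    rw [mem_coe, mem_filter]
    simp only [vadd_eq_add] at hx2 ⊢
    rw [add_sub_cancel_left]
    exact ⟨hs, by rwa [add_comm] at hx2⟩
  · intro s _
    simp only [add_sub_cancel_right]
  · intro x _
    simp only [sub_add_cancel]

/-- Likewise the number of `d`-run-starts `{s ∈ S : s − d ∉ S}` is `c_d(S)` (`c_{−d} = c_d`).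
[cite: Grynkiewicz2009, §2] -/
theorem card_filter_sub_notMem (d : G) (S : Finset G) :
    #(S.filter fun s => s - d ∉ S) = componentCount d S := by
  have h := card_filter_add_notMem (-d) S
  simp only [← sub_eq_add_neg] at h
  rw [componentCount_neg_left] at h
  exact h

/-- **Terminal configuration, first step: every `d`-run-end of `A` has a predecessor** (no
`d`-component of `A` is a single point; print p. 34: «So we can assume `|A_i| = 2` for `i = 1, 2`»,
whose printed derivation compares the end terms of the components of `A₁ + B` with `A₂ + B`).  Setting:
`|A| = |B| = 4`, `d ≠ 0`, `c_d(A) = c_d(B) = c_d(A + B) = 2`, every element of `A + B` has exactly two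
representations, and `d⊆(A, QP) ≥ 2`.  If `u ∈ A` had `u ± d ∉ A`: the run-ends of `A` are `{u, w}`, the
run-starts `{u, s}`, with `w ≠ s` (otherwise the two remaining elements of `A` form a `⟨d⟩`-coset,
`2d = 0`, and `A ∪ {u + d}` is quasi-periodic — excluded by (47)); a run-end (run-start) `c` of `A + B`
has both its representations with run-end (run-start) coordinates, so one of them uses `u`: the four
run-ends/starts of `A + B` are exactly `u + B`; reading off `u + v`, `u + v + d` for the two non-ends
`v` of `B` shows `B = {v₁, v₂} + {0, d}` with `v_i − d, v_i + 2d ∉ B`, the run-starts of `A + B` are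
`u + {v₁, v₂} = s + {v₁, v₂}` and the run-ends `u + d + {v₁, v₂} = w + d + {v₁, v₂}`, whence
`s − u = v₂ − v₁ = w − u`, `s = w` — contradiction. [cite: Grynkiewicz2009, §6 Subcase 4 (p. 34)] -/
theorem sub_mem_of_add_notMem_terminal {A B : Finset G} {d : G} (hd0 : d ≠ 0) (hA4 : #A = 4)
    (hB4 : #B = 4) (hcA : componentCount d A = 2) (hcB : componentCount d B = 2)
    (hcC : componentCount d (A + B) = 2)
    (hr : ∀ c ∈ A + B, #((A ×ˢ B).filter fun p : G × G => p.1 + p.2 = c) = 2)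
    (h47A : 2 ≤ subsetDist A {P | IsQuasiPeriodic P})
    {u : G} (hu : u ∈ A) (hud : u + d ∉ A) : u - d ∈ A := by
  classical
  by_contra hus
  -- run-ends and run-starts of `A`, `B`, `A + B`
  set EA := A.filter fun x => x + d ∉ A with hEA
  set SA := A.filter fun x => x - d ∉ A with hSA
  set EB := B.filter fun y => y + d ∉ B with hEB
  set SB := B.filter fun y => y - d ∉ B with hSB
  set EC := (A + B).filter fun c => c + d ∉ A + B with hEC
  set SC := (A + B).filter fun c => c - d ∉ A + B with hSC
  have memEA : ∀ x, x ∈ EA ↔ x ∈ A ∧ x + d ∉ A := fun x => by rw [hEA, mem_filter]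
  have memSA : ∀ x, x ∈ SA ↔ x ∈ A ∧ x - d ∉ A := fun x => by rw [hSA, mem_filter]
  have memEB : ∀ y, y ∈ EB ↔ y ∈ B ∧ y + d ∉ B := fun y => by rw [hEB, mem_filter]
  have memSB : ∀ y, y ∈ SB ↔ y ∈ B ∧ y - d ∉ B := fun y => by rw [hSB, mem_filter]
  have memEC : ∀ c, c ∈ EC ↔ c ∈ A + B ∧ c + d ∉ A + B := fun c => by rw [hEC, mem_filter]
  have memSC : ∀ c, c ∈ SC ↔ c ∈ A + B ∧ c - d ∉ A + B := fun c => by rw [hSC, mem_filter]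
  have hcEA : #EA = 2 := by rw [hEA, card_filter_add_notMem, hcA]
  have hcSA : #SA = 2 := by rw [hSA, card_filter_sub_notMem, hcA]
  have hcEB : #EB = 2 := by rw [hEB, card_filter_add_notMem, hcB]
  have hcSB : #SB = 2 := by rw [hSB, card_filter_sub_notMem, hcB]
  have hcEC : #EC = 2 := by rw [hEC, card_filter_add_notMem, hcC]
  have hcSC : #SC = 2 := by rw [hSC, card_filter_sub_notMem, hcC]
  have huE : u ∈ EA := (memEA u).2 ⟨hu, hud⟩
  have huS : u ∈ SA := (memSA u).2 ⟨hu, hus⟩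
  -- `EA = {u, w}`, `SA = {u, s}`
  obtain ⟨w, hw⟩ := card_eq_one.1 (show #(EA.erase u) = 1 by rw [card_erase_of_mem huE, hcEA])
  obtain ⟨s, hs⟩ := card_eq_one.1 (show #(SA.erase u) = 1 by rw [card_erase_of_mem huS, hcSA])
  have hwE : w ∈ EA.erase u := by rw [hw]; exact mem_singleton_self w
  have hsS : s ∈ SA.erase u := by rw [hs]; exact mem_singleton_self s
  rw [mem_erase] at hwE hsS
  have hEAeq : EA = {u, w} := by rw [← insert_erase huE, hw]
  have hSAeq : SA = {u, s} := by rw [← insert_erase huS, hs]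
  have hwA : w ∈ A ∧ w + d ∉ A := (memEA w).1 hwE.2
  have hsA : s ∈ A ∧ s - d ∉ A := (memSA s).1 hsS.2
  /- `w ≠ s`: otherwise `A ∖ {u, w}` is a `⟨d⟩`-coset, `2d = 0`, and `A ∪ {u + d}` is quasi-periodic -/
  have hws : w ≠ s := by
    intro hws
    set N := (A.erase u).erase w with hN
    have hNmem : ∀ n, n ∈ N ↔ n ≠ w ∧ n ≠ u ∧ n ∈ A := fun n => by
      rw [hN, mem_erase, mem_erase]
    have hcN : #N = 2 := by
      rw [hN, card_erase_of_mem (mem_erase.2 ⟨hwE.1, hwA.1⟩), card_erase_of_mem hu, hA4]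
    have hNd : ∀ n ∈ N, n + d ∈ N := by
      intro n hn
      obtain ⟨hnw, hnu, hnA⟩ := (hNmem n).1 hn
      have hnd : n + d ∈ A := by
        by_contra h
        have hnE : n ∈ EA := (memEA n).2 ⟨hnA, h⟩
        rw [hEAeq, mem_insert, mem_singleton] at hnE
        rcases hnE with h1 | h1
        · exact hnu h1
        · exact hnw h1
      refine (hNmem _).2 ⟨fun h => ?_, fun h => ?_, hnd⟩
      · apply hsA.2
        rw [← hws, ← h, add_sub_cancel_right]; exact hnA
      · apply hus
        rw [← h, add_sub_cancel_right]; exact hnA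
    have hdN : d +ᵥ N = N := by
      refine eq_of_subset_of_card_le (fun x hx => ?_) (by rw [card_vadd_finset])
      obtain ⟨n, hn, rfl⟩ := mem_vadd_finset.1 hx
      rw [vadd_eq_add, add_comm]; exact hNd n hn
    obtain ⟨n₁, hn₁⟩ : N.Nonempty := card_pos.1 (by omega)
    have hn₂ := hNd n₁ hn₁
    have hn₃ := hNd _ hn₂
    have hne : n₁ + d ≠ n₁ := fun h => hd0 (add_eq_left.1 h)
    have hNeq : N = {n₁, n₁ + d} := by
      symm
      refine eq_of_subset_of_card_le (fun x hx => ?_) (by rw [hcN, card_pair hne.symm])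
      rw [mem_insert, mem_singleton] at hx
      rcases hx with rfl | rfl
      · exact hn₁
      · exact hn₂
    have h2d : d + d = 0 := by
      rw [hNeq, mem_insert, mem_singleton] at hn₃
      rcases hn₃ with h | h
      · rw [add_assoc] at h; exact add_eq_left.1 h
      · exact absurd (add_eq_left.1 h) hd0
    -- the quasi-periodic decomposition of `A ∪ {u + d}` with quasi-period `⟨d⟩`
    set P₁ := insert (u + d) (insert u N) with hP₁
    have hP₁d : d +ᵥ P₁ = P₁ := by
      rw [hP₁, vadd_finset_insert, vadd_finset_insert, hdN, vadd_eq_add, vadd_eq_add,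
        show d + (u + d) = u by rw [add_comm u d, ← add_assoc, h2d, zero_add], add_comm d u,
        Finset.insert_comm]
    have hqp : IsQuasiPeriodic (insert (u + d) A) := by
      refine ⟨AddSubgroup.zmultiples d, P₁, {w}, ⟨?_, ?_, ?_, isPeriodicWith_zmultiples_of_vadd_eq hP₁d,
        ?_⟩, ⟨u + d, by rw [hP₁]; exact mem_insert_self _ _⟩⟩
      · rw [Ne, AddSubgroup.zmultiples_eq_bot]; exact hd0
      · rw [disjoint_singleton_right, hP₁, mem_insert, mem_insert, not_or, not_or]
        exact ⟨fun h => hud (h ▸ hwA.1), fun h => hwE.1 h, fun h => ((hNmem w).1 h).1 rfl⟩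
      · ext x
        rw [mem_union, hP₁, mem_insert, mem_insert, mem_singleton, mem_insert, hNmem]
        constructor
        · rintro ((h1 | h1 | ⟨-, -, hx⟩) | h1)
          · exact Or.inl h1
          · exact Or.inr (h1 ▸ hu)
          · exact Or.inr hx
          · exact Or.inr (h1 ▸ hwA.1)
        · rintro (h1 | hx)
          · exact Or.inl (Or.inl h1)
          · by_cases hxw : x = w
            · exact Or.inr hxw
            by_cases hxu : x = u
            · exact Or.inl (Or.inr (Or.inl hxu))
            exact Or.inl (Or.inr (Or.inr ⟨hxw, hxu, hx⟩))
      · intro x hx y hy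
        rw [mem_singleton] at hx hy
        rw [hx, hy, sub_self]
        exact AddSubgroup.zero_mem _
    have hle := subsetDist_le (𝒮 := {P | IsQuasiPeriodic P}) hqp (subset_insert (u + d) A)
    rw [insert_sdiff_of_notMem A hud, Finset.sdiff_self, Finset.insert_empty, card_singleton] at hle
    have h21 : (2 : ℕ∞) ≤ 1 := h47A.trans (by exact_mod_cast hle)
    exact absurd h21 (by norm_num)
  /- representations -/
  have memR : ∀ (c : G) (p : G × G), p ∈ (A ×ˢ B).filter (fun p : G × G => p.1 + p.2 = c) ↔
      p.1 ∈ A ∧ p.2 ∈ B ∧ p.1 + p.2 = c := fun c p => by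
    rw [mem_filter, mem_product, and_assoc]
  have two : ∀ c ∈ A + B, ∃ p q : G × G, p.1 ∈ A ∧ p.2 ∈ B ∧ p.1 + p.2 = c ∧
      q.1 ∈ A ∧ q.2 ∈ B ∧ q.1 + q.2 = c ∧ p.1 ≠ q.1 := by
    intro c hc
    obtain ⟨p, q, hpq, hF⟩ := card_eq_two.1 (hr c hc)
    have hp : p ∈ (A ×ˢ B).filter (fun p : G × G => p.1 + p.2 = c) := by
      rw [hF]; exact mem_insert_self _ _
    have hq : q ∈ (A ×ˢ B).filter (fun p : G × G => p.1 + p.2 = c) := by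
      rw [hF]; exact mem_insert_of_mem (mem_singleton_self _)
    rw [memR] at hp hq
    refine ⟨p, q, hp.1, hp.2.1, hp.2.2, hq.1, hq.2.1, hq.2.2, fun h => hpq (Prod.ext h ?_)⟩
    have := hp.2.2.trans hq.2.2.symm
    rw [h] at this
    exact add_left_cancel this
  have endA : ∀ {x y c : G}, y ∈ B → x + y = c → c + d ∉ A + B → x + d ∉ A :=
    fun hy hc h hxd => h (by rw [← hc, add_right_comm]; exact add_mem_add hxd hy)
  have endB : ∀ {x y c : G}, x ∈ A → x + y = c → c + d ∉ A + B → y + d ∉ B :=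
    fun hx hc h hyd => h (by rw [← hc, add_assoc]; exact add_mem_add hx hyd)
  have startA : ∀ {x y c : G}, y ∈ B → x + y = c → c - d ∉ A + B → x - d ∉ A :=
    fun hy hc h hxd => h (by rw [← hc, ← sub_add_eq_add_sub]; exact add_mem_add hxd hy)
  have startB : ∀ {x y c : G}, x ∈ A → x + y = c → c - d ∉ A + B → y - d ∉ B :=
    fun hx hc h hyd => h (by rw [← hc, add_sub_assoc]; exact add_mem_add hx hyd)
  /- run-ends of `A + B` lie in `u + EB` and in `w + EB`; run-starts in `u + SB` and in `s + SB` -/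
  have hECsub : ∀ c ∈ EC, c ∈ u +ᵥ EB ∧ c ∈ w +ᵥ EB := by
    intro c hc
    obtain ⟨hcC, hcd⟩ := (memEC c).1 hc
    obtain ⟨p, q, hp1, hp2, hp3, hq1, hq2, hq3, hne⟩ := two c hcC
    have hp1E : p.1 ∈ EA := (memEA _).2 ⟨hp1, endA hp2 hp3 hcd⟩
    have hq1E : q.1 ∈ EA := (memEA _).2 ⟨hq1, endA hq2 hq3 hcd⟩
    have hp2E : p.2 ∈ EB := (memEB _).2 ⟨hp2, endB hp1 hp3 hcd⟩
    have hq2E : q.2 ∈ EB := (memEB _).2 ⟨hq2, endB hq1 hq3 hcd⟩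
    rw [hEAeq, mem_insert, mem_singleton] at hp1E hq1E
    rcases hp1E with hpu | hpw <;> rcases hq1E with hqu | hqw
    · exact absurd (hpu.trans hqu.symm) hne
    · exact ⟨mem_vadd_finset.2 ⟨p.2, hp2E, by rw [vadd_eq_add, ← hpu, hp3]⟩,
        mem_vadd_finset.2 ⟨q.2, hq2E, by rw [vadd_eq_add, ← hqw, hq3]⟩⟩
    · exact ⟨mem_vadd_finset.2 ⟨q.2, hq2E, by rw [vadd_eq_add, ← hqu, hq3]⟩,
        mem_vadd_finset.2 ⟨p.2, hp2E, by rw [vadd_eq_add, ← hpw, hp3]⟩⟩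
    · exact absurd (hpw.trans hqw.symm) hne
  have hSCsub : ∀ c ∈ SC, c ∈ u +ᵥ SB ∧ c ∈ s +ᵥ SB := by
    intro c hc
    obtain ⟨hcC, hcd⟩ := (memSC c).1 hc
    obtain ⟨p, q, hp1, hp2, hp3, hq1, hq2, hq3, hne⟩ := two c hcC
    have hp1S : p.1 ∈ SA := (memSA _).2 ⟨hp1, startA hp2 hp3 hcd⟩
    have hq1S : q.1 ∈ SA := (memSA _).2 ⟨hq1, startA hq2 hq3 hcd⟩
    have hp2S : p.2 ∈ SB := (memSB _).2 ⟨hp2, startB hp1 hp3 hcd⟩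
    have hq2S : q.2 ∈ SB := (memSB _).2 ⟨hq2, startB hq1 hq3 hcd⟩
    rw [hSAeq, mem_insert, mem_singleton] at hp1S hq1S
    rcases hp1S with hpu | hps <;> rcases hq1S with hqu | hqs
    · exact absurd (hpu.trans hqu.symm) hne
    · exact ⟨mem_vadd_finset.2 ⟨p.2, hp2S, by rw [vadd_eq_add, ← hpu, hp3]⟩,
        mem_vadd_finset.2 ⟨q.2, hq2S, by rw [vadd_eq_add, ← hqs, hq3]⟩⟩
    · exact ⟨mem_vadd_finset.2 ⟨q.2, hq2S, by rw [vadd_eq_add, ← hqu, hq3]⟩,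
        mem_vadd_finset.2 ⟨p.2, hp2S, by rw [vadd_eq_add, ← hps, hp3]⟩⟩
    · exact absurd (hps.trans hqs.symm) hne
  /- no element of `A + B` is both a run-end and a run-start (that would force `w = s`) -/
  have hdisj : Disjoint EC SC := by
    rw [disjoint_left]
    intro c hcE hcS
    obtain ⟨hcC, hcd⟩ := (memEC c).1 hcE
    obtain ⟨-, hcd'⟩ := (memSC c).1 hcS
    obtain ⟨p, q, hp1, hp2, hp3, hq1, hq2, hq3, hne⟩ := two c hcC
    have hp1E : p.1 ∈ EA := (memEA _).2 ⟨hp1, endA hp2 hp3 hcd⟩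
    have hq1E : q.1 ∈ EA := (memEA _).2 ⟨hq1, endA hq2 hq3 hcd⟩
    have hp1S : p.1 ∈ SA := (memSA _).2 ⟨hp1, startA hp2 hp3 hcd'⟩
    have hq1S : q.1 ∈ SA := (memSA _).2 ⟨hq1, startA hq2 hq3 hcd'⟩
    rw [hEAeq, mem_insert, mem_singleton] at hp1E hq1E
    rw [hSAeq, mem_insert, mem_singleton] at hp1S hq1S
    rcases hp1E with hpu | hpw
    · have hqw : q.1 = w := hq1E.resolve_left fun h => hne (hpu.trans h.symm)
      have hqs : q.1 = s := hq1S.resolve_left fun h => hne (hpu.trans h.symm)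
      exact hws (hqw.symm.trans hqs)
    · have hps : p.1 = s := hp1S.resolve_left fun h => hwE.1 (hpw.symm.trans h)
      exact hws (hpw.symm.trans hps)
  /- hence `u + B = EC ∪ SC` -/
  have hUsub : EC ∪ SC ⊆ u +ᵥ B := by
    intro c hc
    rw [mem_union] at hc
    rcases hc with hc | hc
    · exact vadd_finset_subset_vadd_finset (filter_subset _ B) (hECsub c hc).1
    · exact vadd_finset_subset_vadd_finset (filter_subset _ B) (hSCsub c hc).1
  have hUeq : EC ∪ SC = u +ᵥ B :=
    eq_of_subset_of_card_le hUsub (by rw [card_vadd_finset, hB4, card_union_of_disjoint hdisj, hcEC, hcSC])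
  /- the non-ends `v` of `B`: `v − d ∉ B` and `v + 2d ∉ B` -/
  have hNB : ∀ v ∈ B, v + d ∈ B → v - d ∉ B ∧ v + d + d ∉ B := by
    intro v hv hvd
    have h1 : u + v ∈ EC ∪ SC := by rw [hUeq]; exact mem_vadd_finset.2 ⟨v, hv, rfl⟩
    have h2 : u + (v + d) ∈ EC ∪ SC := by rw [hUeq]; exact mem_vadd_finset.2 ⟨v + d, hvd, rfl⟩
    rw [mem_union] at h1 h2
    have huvC : u + v ∈ A + B := add_mem_add hu hv
    have huvdC : u + v + d ∈ A + B := by rw [add_assoc]; exact add_mem_add hu hvd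
    have h1' : u + v ∈ SC := by
      rcases h1 with h1 | h1
      · exact absurd huvdC ((memEC _).1 h1).2
      · exact h1
    have h2' : u + (v + d) ∈ EC := by
      rcases h2 with h2 | h2
      · exact h2
      · exfalso
        apply ((memSC _).1 h2).2
        rw [← add_assoc, add_sub_cancel_right]; exact huvC
    constructor
    · intro hvd'
      apply ((memSC _).1 h1').2
      rw [add_sub_assoc]; exact add_mem_add hu hvd'
    · intro hvdd
      apply ((memEC _).1 h2').2
      rw [add_assoc]; exact add_mem_add hu hvdd
  /- so the run-starts of `B` are its two non-ends `NB`, and its run-ends are `d + NB` -/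
  set NB := B.filter fun v => v + d ∈ B with hNB'
  have memNB : ∀ v, v ∈ NB ↔ v ∈ B ∧ v + d ∈ B := fun v => by rw [hNB', mem_filter]
  have hcNB : #NB = 2 := by
    have h := Finset.card_filter_add_card_filter_not (s := B) (fun v => v + d ∈ B)
    rw [hB4] at h
    change #NB + #EB = 4 at h
    omega
  have hSBeq : SB = NB := by
    symm
    refine eq_of_subset_of_card_le (fun v hv => ?_) (by rw [hcSB, hcNB])
    obtain ⟨hvB, hvd⟩ := (memNB v).1 hv
    exact (memSB v).2 ⟨hvB, (hNB v hvB hvd).1⟩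
  have hEBeq : EB = d +ᵥ NB := by
    symm
    refine eq_of_subset_of_card_le (fun x hx => ?_) (by rw [card_vadd_finset, hcEB, hcNB])
    obtain ⟨v, hv, rfl⟩ := mem_vadd_finset.1 hx
    obtain ⟨hvB, hvd⟩ := (memNB v).1 hv
    rw [vadd_eq_add, add_comm]
    exact (memEB _).2 ⟨hvd, (hNB v hvB hvd).2⟩
  /- `SC = u + NB = s + NB`, `EC = u + d + NB = w + d + NB` -/
  have hSC1 : SC = u +ᵥ NB := by
    refine eq_of_subset_of_card_le (fun c hc => ?_) (by rw [card_vadd_finset, hcSC, hcNB])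
    rw [← hSBeq]; exact (hSCsub c hc).1
  have hSC2 : SC = s +ᵥ NB := by
    refine eq_of_subset_of_card_le (fun c hc => ?_) (by rw [card_vadd_finset, hcSC, hcNB])
    rw [← hSBeq]; exact (hSCsub c hc).2
  have hEC1 : EC = u +ᵥ (d +ᵥ NB) := by
    refine eq_of_subset_of_card_le (fun c hc => ?_)
      (by rw [card_vadd_finset, card_vadd_finset, hcEC, hcNB])
    rw [← hEBeq]; exact (hECsub c hc).1
  have hEC2 : EC = w +ᵥ (d +ᵥ NB) := by
    refine eq_of_subset_of_card_le (fun c hc => ?_)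
      (by rw [card_vadd_finset, card_vadd_finset, hcEC, hcNB])
    rw [← hEBeq]; exact (hECsub c hc).2
  /- compare: `s − u = v₂ − v₁ = w − u` -/
  obtain ⟨v₁, v₂, hv12, hNBeq⟩ := card_eq_two.1 hcNB
  have key : ∀ x : G, x +ᵥ NB = u +ᵥ NB → x ≠ u → x + v₁ = u + v₂ := by
    intro x hx hxu
    have hmem : x + v₁ ∈ u +ᵥ NB := by
      rw [← hx]; exact mem_vadd_finset.2 ⟨v₁, by rw [hNBeq]; exact mem_insert_self _ _, rfl⟩
    rw [hNBeq, vadd_finset_insert, vadd_finset_singleton, mem_insert, mem_singleton, vadd_eq_add,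
      vadd_eq_add] at hmem
    rcases hmem with h | h
    · exact absurd (add_right_cancel h) hxu
    · exact h
  have h1 : s + v₁ = u + v₂ := key s (hSC2.symm.trans hSC1) hsS.1
  have h2 : w + v₁ = u + v₂ := by
    refine key w ?_ hwE.1
    have h := hEC2.symm.trans hEC1
    rw [vadd_vadd, vadd_vadd, add_comm w d, add_comm u d, ← vadd_vadd, ← vadd_vadd] at h
    have h' := congrArg (fun S : Finset G => (-d) +ᵥ S) h
    simp only [neg_vadd_vadd] at h'
    exact h'
  exact hws (add_right_cancel (h2.trans h1.symm))

/-- **Terminal configuration, last step** (print p. 34, last paragraph: «all four of the end terms are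
unique expression elements … the only way that these four terms can all not be unique expression
elements in `A + B` is if `A₂ + B₁ = A₁ + B₂` and `A₂ + B₂ = A₁ + B₁` … a contradiction»; rendered by
representation counting).  If every `d`-run-end of `A` and of `B` has a predecessor, every element of
`A + B` has exactly two representations and `c_d(A + B) = 2`, `d ≠ 0`: contradiction — a run-end `c`
of `A + B` has its two representations `(x, y)`, `(x′, y′)` with run-end coordinates, and then
`(x − d, y)`, `(x, y − d)`, `(x′, y′ − d)` are three distinct representations of `c − d`.
[cite: Grynkiewicz2009, §6 Subcase 4 (p. 34)] -/
theorem false_of_forall_sub_mem_terminal {A B : Finset G} {d : G} (hd0 : d ≠ 0)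
    (hcC : componentCount d (A + B) = 2)
    (hr : ∀ c ∈ A + B, #((A ×ˢ B).filter fun p : G × G => p.1 + p.2 = c) = 2)
    (hPA : ∀ x ∈ A, x + d ∉ A → x - d ∈ A) (hPB : ∀ y ∈ B, y + d ∉ B → y - d ∈ B) : False := by
  classical
  have memR : ∀ (c : G) (p : G × G), p ∈ (A ×ˢ B).filter (fun p : G × G => p.1 + p.2 = c) ↔
      p.1 ∈ A ∧ p.2 ∈ B ∧ p.1 + p.2 = c := fun c p => by
    rw [mem_filter, mem_product, and_assoc]
  -- a run-end `c` of `A + B`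
  have hcEC : #((A + B).filter fun c => c + d ∉ A + B) = 2 := by rw [card_filter_add_notMem, hcC]
  obtain ⟨c, hc⟩ : ((A + B).filter fun c => c + d ∉ A + B).Nonempty := card_pos.1 (by omega)
  rw [mem_filter] at hc
  obtain ⟨hcC, hcd⟩ := hc
  -- its two representations
  obtain ⟨p, q, hpq, hF⟩ := card_eq_two.1 (hr c hcC)
  have hp : p ∈ (A ×ˢ B).filter (fun p : G × G => p.1 + p.2 = c) := by
    rw [hF]; exact mem_insert_self _ _
  have hq : q ∈ (A ×ˢ B).filter (fun p : G × G => p.1 + p.2 = c) := by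
    rw [hF]; exact mem_insert_of_mem (mem_singleton_self _)
  rw [memR] at hp hq
  obtain ⟨hp1, hp2, hp3⟩ := hp
  obtain ⟨hq1, hq2, hq3⟩ := hq
  have hne1 : p.1 ≠ q.1 := fun h => hpq (Prod.ext h (by
    have := hp3.trans hq3.symm
    rw [h] at this
    exact add_left_cancel this))
  -- the coordinates are run-ends, hence have predecessors
  have hp1d : p.1 + d ∉ A := fun h => hcd (by rw [← hp3, add_right_comm]; exact add_mem_add h hp2)
  have hq1d : q.1 + d ∉ A := fun h => hcd (by rw [← hq3, add_right_comm]; exact add_mem_add h hq2)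
  have hp2d : p.2 + d ∉ B := fun h => hcd (by rw [← hp3, add_assoc]; exact add_mem_add hp1 h)
  have hq2d : q.2 + d ∉ B := fun h => hcd (by rw [← hq3, add_assoc]; exact add_mem_add hq1 h)
  have hp1' := hPA _ hp1 hp1d
  have hp2' := hPB _ hp2 hp2d
  have hq2' := hPB _ hq2 hq2d
  -- three distinct representations of `c − d`
  have hcdC : c - d ∈ A + B := by
    rw [← hp3, ← sub_add_eq_add_sub]; exact add_mem_add hp1' hp2
  have hm1 : (p.1 - d, p.2) ∈ (A ×ˢ B).filter (fun r : G × G => r.1 + r.2 = c - d) :=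
    (memR _ _).2 ⟨hp1', hp2, by rw [← hp3, sub_add_eq_add_sub]⟩
  have hm2 : (p.1, p.2 - d) ∈ (A ×ˢ B).filter (fun r : G × G => r.1 + r.2 = c - d) :=
    (memR _ _).2 ⟨hp1, hp2', by rw [← hp3, add_sub_assoc]⟩
  have hm3 : (q.1, q.2 - d) ∈ (A ×ˢ B).filter (fun r : G × G => r.1 + r.2 = c - d) :=
    (memR _ _).2 ⟨hq1, hq2', by rw [← hq3, add_sub_assoc]⟩
  have h12 : (p.1 - d, p.2) ≠ (p.1, p.2 - d) := fun h => by
    have h1 : p.1 - d = p.1 := (Prod.mk.inj h).1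
    exact hd0 (by rwa [sub_eq_self] at h1)
  have h13 : (p.1 - d, p.2) ≠ (q.1, q.2 - d) := fun h => by
    have h1 : p.1 - d = q.1 := (Prod.mk.inj h).1
    apply hq1d
    rw [← h1, sub_add_cancel]; exact hp1
  have h23 : (p.1, p.2 - d) ≠ (q.1, q.2 - d) := fun h => hne1 (Prod.mk.inj h).1
  have hlt : 2 < #((A ×ˢ B).filter fun r : G × G => r.1 + r.2 = c - d) :=
    two_lt_card_iff.2 ⟨_, _, _, hm1, hm2, hm3, h12, h13, h23⟩
  rw [hr (c - d) hcdC] at hlt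
  exact lt_irrefl _ hlt

/-- **The terminal configuration is contradictory** (print p. 33 last ¶ – p. 34): `|A| = |B| = 4`,
`|A + B| = |A| + |B|`, `A + B` not quasi-periodic, `⟨A⟩ = G`, `d⊆(A, QP) ≥ 2`, `d⊆(A, QAP_f) ≥ 2`
(`f ≠ 0`), `d⊆(B, QP) ≥ 2`, `|N₁ᵇ(A, B)| ≤ 1` (Claim 8), `|\overline{A + B}| ≥ 4` (Claim 10), `d ≠ 0`,
`c_d(A) = c_d(B) = c_d(A + B) = 2`.  FIRST («Suppose `|N₁ᵇ(A, B)| > 0` …»): a unique expression element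
`a + b` makes `(A, B ∖ b)` a pair with `|A + (B ∖ b)| = |A| + |B ∖ b|` and `A + (B ∖ b) = (A + B) ∖ γ`
aperiodic ((45)); the theorem holds for it (`conclusion_of_min_card_le_three`, `min = 3`), and
`card_le_of_conclusion` (the print's KST / Corollary 4.3 step) bounds `|G| ≤ |A + B| + 1` or
`|G| = 10` — both below `|A + B| + |\overline{A + B}| ≥ 12`.  So every element of `A + B` has `≥ 2`,
hence (`Σ r = |A||B| = 16 = 2 |A + B|`, `sum_addConvolution`) exactly `2` representations.  THEN the
`d`-component analysis: `sub_mem_of_add_notMem_terminal` for `(A, B)` and for `(B, A)`, and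
`false_of_forall_sub_mem_terminal`. [cite: Grynkiewicz2009, §6 Subcase 4 (pp. 33–34)] -/
theorem terminal_false [Fintype G] {A B : Finset G} {d : G} (h0A : (0 : G) ∈ A) (h0B : (0 : G) ∈ B)
    (hA4 : #A = 4) (hB4 : #B = 4) (hAB : #(A + B) = #A + #B) (h45 : ¬ IsQuasiPeriodic (A + B))
    (hgenA : AddSubgroup.closure (A : Set G) = ⊤) (h47A : 2 ≤ subsetDist A {P | IsQuasiPeriodic P})
    (h50A : ∀ f : G, f ≠ 0 → 2 ≤ subsetDist A {P | IsQuasiProgression f P})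
    (h47B : 2 ≤ subsetDist B {P | IsQuasiPeriodic P})
    (hN1 : ∀ b ∈ B, #(layerWith A B 1 {b}) ≤ 1) (hC4 : 4 ≤ #(A + B)ᶜ) (hd0 : d ≠ 0)
    (hcA : componentCount d A = 2) (hcB : componentCount d B = 2)
    (hcAB : componentCount d (A + B) = 2) : False := by
  classical
  have hAne : A.Nonempty := ⟨0, h0A⟩
  have hBne : B.Nonempty := ⟨0, h0B⟩
  have hcardG : #(A + B) + #(A + B)ᶜ = Fintype.card G := by
    rw [card_compl]; have := card_le_univ (A + B); omega
  /- no unique expression elements -/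
  have hzero : ∀ b ∈ B, #(layerWith A B 1 {b}) = 0 := by
    intro b hb
    by_contra hne
    have hNb : #(layerWith A B 1 {b}) = 1 := by have := hN1 b hb; omega
    -- the pair `(A, B ∖ b)`
    set B' := B.erase b with hB'
    have hB'card : #B' = #B - 1 := card_erase_of_mem hb
    have hB'ne : B'.Nonempty := card_pos.1 (by omega)
    have hsplit : A + B' = (A + B) \ layerWithin A B 1 {b} := by
      have := add_nsmul_add_sdiff_eq (A := A) (B := B) (U := {b}) (i := 1) le_rfl
      rwa [Nat.sub_self, zero_nsmul, add_zero, one_nsmul, sdiff_singleton_eq_erase] at this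
    have hWsub : layerWithin A B 1 {b} ⊆ A + B := fun x hx => by
      have := (mem_layerWithin.1 hx).1
      rwa [one_nsmul] at this
    have hWeq : layerWithin A B 1 {b} = layerWith A B 1 {b} := by
      refine Subset.antisymm (fun x hx => ?_) (fun x hx => ?_)
      · rw [mem_layerWithin] at hx
        rw [mem_layerWith]
        refine ⟨hx.1, Subset.antisymm hx.2 ?_⟩
        have hx1 := hx.1
        rw [one_nsmul] at hx1
        obtain ⟨a, ha, y, hy, rfl⟩ := mem_add.1 hx1
        have hyT : y ∈ repTrace A B 1 (a + y) := by
          rw [mem_repTrace, Nat.sub_self, zero_nsmul, add_zero, add_sub_cancel_right]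
          exact ⟨hy, ha⟩
        have := hx.2 hyT
        rw [mem_singleton] at this
        subst this
        exact singleton_subset_iff.2 hyT
      · rw [mem_layerWith] at hx
        rw [mem_layerWithin]
        exact ⟨hx.1, hx.2.le⟩
    have hsub' : A + B' ⊆ A + B := add_subset_add_left (erase_subset b B)
    have hsdiff : (A + B) \ (A + B') = layerWith A B 1 {b} := by
      rw [hsplit, Finset.sdiff_sdiff_eq_self hWsub, hWeq]
    have hAB' : #(A + B') = #A + #B' := by
      have h := card_sdiff_add_card_eq_card hsub'
      rw [hsdiff, hNb] at h
      omega
    have hap' : (A + B').addStab = {0} :=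
      addStab_eq_of_card_sdiff_le_one hsub' (by rw [hsdiff, hNb]) (hAne.add hB'ne) h45
    have hmin : min #A #B' ≤ 3 := by rw [hB'card, hB4]; exact Nat.min_le_right _ _
    have hconcl := conclusion_of_min_card_le_three hAne hB'ne hAB' hap' hmin
    have hbound := card_le_of_conclusion h0A (by omega) (by omega) hAB' hap' hgenA h47A h50A hconcl
    clear hconcl
    have hle := card_le_card hsub'
    rcases hbound with h1 | ⟨-, h2⟩
    · omega
    · omega
  have hrep : ∀ c ∈ A + B, 2 ≤ A.addConvolution B c := by
    intro c hc
    have hpos : 0 < A.addConvolution B c := addConvolution_pos.2 hc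
    by_contra hlt
    have h1 : A.addConvolution B c = 1 := by omega
    obtain ⟨a, ha, b, hb, rfl⟩ := mem_add.1 hc
    have hcard := hzero b hb
    rw [card_layerWith_one_singleton hb, card_eq_zero, filter_eq_empty_iff] at hcard
    exact hcard ha h1
  -- hence exactly two representations everywhere
  have hr : ∀ c ∈ A + B, #((A ×ˢ B).filter fun p : G × G => p.1 + p.2 = c) = 2 := by
    have hsum := sum_addConvolution A B
    have hall : ∀ c ∈ A + B, A.addConvolution B c = 2 := by
      by_contra hne
      push Not at hne
      obtain ⟨c₀, hc₀, hne⟩ := hne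
      have hlt : ∑ c ∈ A + B, (2 : ℕ) < ∑ c ∈ A + B, A.addConvolution B c :=
        sum_lt_sum (fun c hc => hrep c hc) ⟨c₀, hc₀, lt_of_le_of_ne (hrep c₀ hc₀) (Ne.symm hne)⟩
      rw [sum_const, smul_eq_mul, hsum, hAB, hA4, hB4] at hlt
      omega
    intro c hc
    exact hall c hc
  /- the `d`-component analysis -/
  have hrBA : ∀ c ∈ B + A, #((B ×ˢ A).filter fun p : G × G => p.1 + p.2 = c) = 2 := by
    intro c hc
    rw [add_comm] at hc
    have h := hr c hc
    have e1 : #((A ×ˢ B).filter fun p : G × G => p.1 + p.2 = c) = A.addConvolution B c := rfl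
    have e2 : #((B ×ˢ A).filter fun p : G × G => p.1 + p.2 = c) = B.addConvolution A c := rfl
    rw [e2, addConvolution_comm, ← e1]
    exact h
  have hcBA : componentCount d (B + A) = 2 := by rw [add_comm]; exact hcAB
  have hPA : ∀ x ∈ A, x + d ∉ A → x - d ∈ A := fun x hx hxd =>
    sub_mem_of_add_notMem_terminal hd0 hA4 hB4 hcA hcB hcAB hr h47A hx hxd
  have hPB : ∀ y ∈ B, y + d ∉ B → y - d ∈ B := fun y hy hyd =>
    sub_mem_of_add_notMem_terminal hd0 hB4 hA4 hcB hcA hcBA hrBA h47B hy hyd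
  exact false_of_forall_sub_mem_terminal hd0 hcAB hr hPA hPB

/-- **§6 Subcase 4** (print pp. 32–34): contradiction.  Hypotheses exactly the antecedents of the
hypothesis `four` of `StepBeyondKempermanFinite.lean` (`subcaseFour_false_of_terminal` +
`terminal_false`). [cite: Grynkiewicz2009, §6 Subcase 4 (pp. 32–34)] -/
theorem subcaseFour_false [Fintype G] : ∀ (A B : Finset G) (e : G), (0 : G) ∈ A → (0 : G) ∈ B → #B ≤ #A → 4 ≤ #B →
        #(A + B) = #A + #B → (A + B).addStab = {0} →
        (∀ P : Finset G, A + B ⊆ P → P.addStab ≠ {0} → 3 ≤ #(P \ (A + B))) →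
        IsNonExtendible A B → IsNonExtendible B A → ¬ IsQuasiPeriodic A → ¬ IsQuasiPeriodic B →
        AddSubgroup.closure (A : Set G) = ⊤ → AddSubgroup.closure (B : Set G) = ⊤ →
        2 ≤ subsetDist A {P | IsQuasiPeriodic P} → 2 ≤ subsetDist B {P | IsQuasiPeriodic P} →
        (∀ P : Finset G, Aᶜ ⊆ P → P.addStab ≠ {0} → 3 ≤ #(P \ Aᶜ)) →
        (∀ P : Finset G, Bᶜ ⊆ P → P.addStab ≠ {0} → 3 ≤ #(P \ Bᶜ)) →
        2 ≤ subsetDist (A + B)ᶜ {P | IsQuasiPeriodic P} →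
        (∀ d : G, d ≠ 0 → 2 ≤ subsetDist A {P | IsQuasiProgression d P}) →
        (∀ d : G, d ≠ 0 → 2 ≤ subsetDist B {P | IsQuasiProgression d P}) →
        (∀ d : G, d ≠ 0 → 2 ≤ subsetDist (A + B)ᶜ {P | IsQuasiProgression d P}) →
        (∀ b ∈ B, #(layerWith A B 1 {b}) ≤ 1) → (∀ a ∈ A, #(layerWith B A 1 {a}) ≤ 1) →
        4 ≤ #(A + B)ᶜ →
        e ∈ A - B → #((e +ᵥ B) ∩ A) = 2 →
        (∀ e' ∈ A - B, #((e' +ᵥ B) ∩ A) < #B → #((e' +ᵥ B) ∩ A) ≤ #((e +ᵥ B) ∩ A)) →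
        (((e +ᵥ B) ∪ A) + ((e +ᵥ B) ∩ A)).addStab = {0} →
        (∀ X Y : Finset G, (0 : G) ∈ X → (0 : G) ∈ Y → 3 ≤ #X → 3 ≤ #Y → #(X + Y) = #X + #Y →
          (X + Y).addStab = {0} →
          (∀ P : Finset G, X + Y ⊆ P → P.addStab ≠ {0} → 2 ≤ #(P \ (X + Y))) →
          IsNonExtendible X Y → IsNonExtendible Y X → ¬ IsQuasiPeriodic X → ¬ IsQuasiPeriodic Y →
          AddSubgroup.closure (X : Set G) = ⊤ → AddSubgroup.closure (Y : Set G) = ⊤ →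
          (min #X #Y < #B ∨ (min #X #Y = #B ∧ #A + #B < #X + #Y)) →
          ((∃ α β : G, #(insert α X + insert β Y) + 1 = #(insert α X) + #(insert β Y)) ∨
            ∃ (K : AddSubgroup G) (X₁ X₀ Y₁ Y₀ : Finset G), IsGrynkiewiczDecomp K X Y X₁ X₀ Y₁ Y₀)) →
        False := by
  intro A B e h0A h0B hBA hB4 hAB haper hP3 hneA hneB hAqp hBqp hgenA hgenB h47A h47B h48A h48B h49
    h50A h50B h51 hN1B _ hC4 _ hY2 _ haper_e IH
  exact subcaseFour_false_of_terminal
    (fun A B d h0A h0B hA4 hB4 hAB h45 hgenA h47A h50A h47B hN1 hC4 hd0 hcA hcB hcAB _ =>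
      terminal_false h0A h0B hA4 hB4 hAB h45 hgenA h47A h50A h47B hN1 hC4 hd0 hcA hcB hcAB)
    h0A h0B hBA hB4 hAB haper hP3 hneA hneB hAqp hBqp hgenA hgenB h47A h47B h48A h48B h49 h50A h50B h51
    hN1B hC4 hY2 haper_e IH

end Grynkiewicz2009

end Literature.Combinatorics.Additive
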